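import Mathlib
import HarnessLib

/-!
# Bilinear forms with Kloosterman fractions: generic range bookkeeping for the Duke–Friedlander–Iwaniec shape

Topic `NumberTheory/LFunctions`.  A bound of the type produced by the amplification method
(Duke–Friedlander–Iwaniec, Invent. Math. 128 (1997); Bettin–Chandee, Adv. Math. 328 (2018)) for
the bilinear form with Kloosterman fractions has the shape
`B ≤ K F R^η (1 + R/MN)^θ ∑ᵢ (MN)^{aᵢ} (M+N)^{bᵢ}` (`R = |k|`, `F = ‖α‖‖β‖`), while the named
fact `DukeFriedlanderIwaniec1997_bilinearKloostermanFractions` wants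
`B ≤ K' F (R + MN)^{3/8} (M+N)^{11/48+ε}`.  Together with the trivial bound `B ≤ 2(MN)^{1/2} F`,
the former implies the latter as soon as four LINEAR inequalities in the exponents hold (the
extreme rays of the polyhedral cone of `(log(M+N), log MN, log R)` on which the trivial bound fails,
using `(M+N)/4 ≤ MN ≤ (M+N)²`).  This file PROVES that once and for all
(`DFI_shape_of_generic_bound`), so that any variant of the exponents (Duke–Friedlander–Iwaniec's,
Bettin–Chandee's, or whatever a formalisation of §§3–5 of the latter ends up with) is converted by
`norm_num` on four numeric side conditions.  Special cases in the tree: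
`DFI_shape_of_BC_and_trivial`, `DFI_shape_of_BC34_and_trivial`, `DFI_shape_of_BC34R_and_trivial`.

## References

* W. Duke, J. Friedlander, H. Iwaniec, Invent. Math. 128 (1997) 23–43, Theorem 2.
  [DukeFriedlanderIwaniec1997]
* S. Bettin, V. Chandee, Adv. Math. 328 (2018) 1234–1262 (arXiv:1502.00769), Theorem 1, §7.
  [BettinChandee2018]
-/

noncomputable section

open Finset Real

namespace Literature.NumberTheory.LFunctions

set_option maxHeartbeats 400000 in
/-- **Generic range bookkeeping.**  Let `M, N ≥ 1/2`, `R ≥ 1`, `F ≥ 0`, `ε > 0`, `K > 0`,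
`θ, η ≥ 0`, and exponents `aᵢ ≥ 0`, `bᵢ` (`i ∈ I`) with, for every `i`,
`2(η + aᵢ) + bᵢ ≤ 47/48 + ε`, `η + aᵢ + bᵢ ≤ 29/48 + ε`,
`(11/6)(η + aᵢ - 3/8) + bᵢ ≤ 11/48 + ε`, `(37/18)(η + θ - 3/8) + 2(aᵢ - θ) + bᵢ ≤ 11/48 + ε`.
If `B ≤ 2 (MN)^{1/2} F` and `B ≤ K F R^η (1 + R/MN)^θ ∑ᵢ (MN)^{aᵢ}(M+N)^{bᵢ}` then
`B ≤ (2 + 4·2^θ·K·#I) F (R + MN)^{3/8} (M+N)^{11/48+ε}`.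
(Cases: `R ≤ MN`; `(MN)^{1/2} ≤ R^{3/8}(M+N)^{11/48}` — trivial bound; and the cone
`MN < R`, `R^{3/8}(M+N)^{11/48} < (MN)^{1/2}`, whose extreme rays give the last two conditions.)
[folklore] -/
theorem DFI_shape_of_generic_bound {ι : Type*} (I : Finset ι) (a b : ι → ℝ)
    {ε K M N R F B θ η : ℝ} (hε : 0 < ε) (hK : 0 < K)
    (hM : 1 / 2 ≤ M) (hN : 1 / 2 ≤ N) (hR : 1 ≤ R) (hF : 0 ≤ F) (hθ : 0 ≤ θ) (hη : 0 ≤ η)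
    (ha : ∀ i ∈ I, 0 ≤ a i)
    (h1 : ∀ i ∈ I, 2 * (η + a i) + b i ≤ 47 / 48 + ε)
    (h2 : ∀ i ∈ I, η + a i + b i ≤ 29 / 48 + ε)
    (h3 : ∀ i ∈ I, 11 / 6 * (η + a i - 3 / 8) + b i ≤ 11 / 48 + ε)
    (h4 : ∀ i ∈ I, 37 / 18 * (η + θ - 3 / 8) + 2 * (a i - θ) + b i ≤ 11 / 48 + ε)
    (htriv : B ≤ 2 * Real.sqrt (M * N) * F)
    (hbd : B ≤ K * F * R ^ η * (1 + R / (M * N)) ^ θ * ∑ i ∈ I, (M * N) ^ (a i) * (M + N) ^ (b i)) :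
    B ≤ (2 + 4 * (2 : ℝ) ^ θ * K * I.card) * F * (R + M * N) ^ (3 / 8 : ℝ) * (M + N) ^ (11 / 48 + ε) := by
  have hM0 : 0 < M := by linarith
  have hN0 : 0 < N := by linarith
  have hQ0 : 0 < M * N := mul_pos hM0 hN0
  have hP1 : 1 ≤ M + N := by linarith
  have hP0 : 0 < M + N := by linarith
  have hR0 : 0 < R := by linarith
  obtain ⟨q, hq⟩ : ∃ q : ℝ, q = Real.log (M * N) := ⟨_, rfl⟩
  obtain ⟨p, hp⟩ : ∃ p : ℝ, p = Real.log (M + N) := ⟨_, rfl⟩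
  obtain ⟨r, hr⟩ : ∃ r : ℝ, r = Real.log R := ⟨_, rfl⟩
  have hp0 : 0 ≤ p := hp ▸ Real.log_nonneg hP1
  have hr0 : 0 ≤ r := hr ▸ Real.log_nonneg hR
  have hqp : q ≤ 2 * p := by
    have e1 : M * N ≤ (M + N) ^ 2 := by nlinarith [sq_nonneg (M - N)]
    have e2 : Real.log (M * N) ≤ Real.log ((M + N) ^ 2) := Real.log_le_log hQ0 e1
    rw [Real.log_pow, ← hq, ← hp] at e2
    push_cast at e2
    linarith
  have hlog4 : Real.log 4 ≤ 1.4 := by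
    have e2 : Real.log 4 = 2 * Real.log 2 := by
      rw [show (4 : ℝ) = 2 ^ 2 by norm_num, Real.log_pow]; push_cast; ring
    rw [e2]
    have := Real.log_two_lt_d9
    linarith
  have hlog40 : 0 ≤ Real.log 4 := Real.log_nonneg (by norm_num)
  have hpq : p - Real.log 4 ≤ q := by
    have e1 : (M + N) / 4 ≤ M * N := by
      rcases le_total M N with h | h
      · nlinarith
      · nlinarith
    have e2 : Real.log ((M + N) / 4) ≤ Real.log (M * N) := Real.log_le_log (by positivity) e1
    rw [Real.log_div hP0.ne' (by norm_num), ← hp, ← hq] at e2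
    linarith
  have eQ : ∀ c : ℝ, (M * N) ^ c = Real.exp (c * q) := fun c => by
    rw [Real.rpow_def_of_pos hQ0, mul_comm, hq]
  have eP : ∀ c : ℝ, (M + N) ^ c = Real.exp (c * p) := fun c => by
    rw [Real.rpow_def_of_pos hP0, mul_comm, hp]
  have eR : ∀ c : ℝ, R ^ c = Real.exp (c * r) := fun c => by
    rw [Real.rpow_def_of_pos hR0, mul_comm, hr]
  have esqrt : Real.sqrt (M * N) = Real.exp (1 / 2 * q) := by
    rw [Real.sqrt_eq_rpow, eQ]
  set G : ℝ := (R + M * N) ^ (3 / 8 : ℝ) * (M + N) ^ (11 / 48 + ε) with hG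
  have hG0 : 0 ≤ G := by positivity
  have hG_r : Real.exp (3 / 8 * r + (11 / 48 + ε) * p) ≤ G := by
    rw [Real.exp_add, hG, ← eR, ← eP]
    gcongr
    linarith
  have hG_q : Real.exp (3 / 8 * q + (11 / 48 + ε) * p) ≤ G := by
    rw [Real.exp_add, hG, ← eQ, ← eP]
    gcongr
    linarith
  have hKF : 0 ≤ K * F := mul_nonneg hK.le hF
  set c2θ : ℝ := (2 : ℝ) ^ θ with hc2θ
  have hc2θ1 : 1 ≤ c2θ := Real.one_le_rpow (by norm_num) hθ
  -- the terms as exponentials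
  have eterm : ∀ i ∈ I, (M * N) ^ (a i) * (M + N) ^ (b i) = Real.exp (a i * q + b i * p) := by
    intro i _; rw [eQ, eP, ← Real.exp_add]
  have hsum_exp : ∑ i ∈ I, (M * N) ^ (a i) * (M + N) ^ (b i) = ∑ i ∈ I, Real.exp (a i * q + b i * p) :=
    Finset.sum_congr rfl eterm
  rw [hsum_exp, eR] at hbd
  -- the constant `e^{(3/8) log 4} = 4^{3/8} ≤ 4^{1/2} = 2`
  have hexpc : Real.exp (3 / 8 * Real.log 4) ≤ 2 := by
    have e1 : Real.exp (3 / 8 * Real.log 4) = (4 : ℝ) ^ (3 / 8 : ℝ) := by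
      rw [Real.rpow_def_of_pos (by norm_num : (0 : ℝ) < 4), mul_comm]
    have e2 : (4 : ℝ) ^ (3 / 8 : ℝ) ≤ (4 : ℝ) ^ (1 / 2 : ℝ) :=
      Real.rpow_le_rpow_of_exponent_le (by norm_num) (by norm_num)
    have e3 : (4 : ℝ) ^ (1 / 2 : ℝ) = 2 := by
      rw [← Real.sqrt_eq_rpow, show (4 : ℝ) = 2 ^ 2 by norm_num, Real.sqrt_sq (by norm_num)]
    rw [e1, ← e3]; exact e2
  -- final constant bookkeeping helper
  have hfinal : ∀ {X : ℝ}, 0 ≤ X → X ≤ G → ∀ {c : ℝ}, 0 ≤ c → c ≤ 2 * c2θ →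
      K * F * c * (I.card * X) ≤ (2 + 4 * c2θ * K * I.card) * F * G := by
    intro X hX0 hXG c hc0 hcle
    have h1 : K * F * c * (I.card * X) ≤ K * F * (2 * c2θ) * (I.card * G) := by gcongr
    have h2 : 0 ≤ F * G := mul_nonneg hF hG0
    have h3 : 0 ≤ c2θ * K * I.card * (F * G) := by positivity
    calc K * F * c * (I.card * X) ≤ K * F * (2 * c2θ) * (I.card * G) := h1
      _ = 2 * (c2θ * K * I.card * (F * G)) := by ring
      _ ≤ (2 + 4 * c2θ * K * I.card) * F * G := by
          have e : (2 + 4 * c2θ * K * I.card) * F * G = 2 * (F * G) + 4 * (c2θ * K * I.card * (F * G)) := by ring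
          rw [e]; linarith
  by_cases hRQ : R ≤ M * N
  · -- Case `R ≤ MN`
    have hrq : r ≤ q := by rw [hr, hq]; exact Real.log_le_log hR0 hRQ
    have hq0 : 0 ≤ q := hr0.trans hrq
    have hfac : (1 + R / (M * N)) ^ θ ≤ c2θ := by
      have e2 : 1 + R / (M * N) ≤ 2 := by
        have e3 : R / (M * N) ≤ 1 := (div_le_one hQ0).mpr hRQ
        linarith only [e3]
      exact Real.rpow_le_rpow (by positivity) e2 hθ
    set X : ℝ := Real.exp (3 / 8 * q + (11 / 48 + ε) * p) with hX
    have hX0 : 0 ≤ X := (Real.exp_pos _).le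
    -- each term: `exp(η r) exp(aᵢ q + bᵢ p) ≤ 2 X`
    have hterm : ∀ i ∈ I, Real.exp (η * r) * Real.exp (a i * q + b i * p) ≤
        Real.exp (3 / 8 * Real.log 4) * X := by
      intro i hi
      rw [hX, ← Real.exp_add, ← Real.exp_add]
      refine Real.exp_le_exp.mpr ?_
      have hai := ha i hi
      have h1i := h1 i hi
      have h2i := h2 i hi
      have hηr : η * r ≤ η * q := mul_le_mul_of_nonneg_left hrq hη
      have h1p : (2 * (η + a i) + b i) * p ≤ (47 / 48 + ε) * p := mul_le_mul_of_nonneg_right h1i hp0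
      have h2p : (η + a i + b i) * p ≤ (29 / 48 + ε) * p := mul_le_mul_of_nonneg_right h2i hp0
      -- the exponent is linear in `q ∈ [max(0, p - log 4), 2p]`: compare at the end-points
      rcases le_or_gt 0 (η + a i - 3 / 8) with hs | hs
      · have e1 : (η + a i - 3 / 8) * q ≤ (η + a i - 3 / 8) * (2 * p) := mul_le_mul_of_nonneg_left hqp hs
        linarith
      · have e1 : (η + a i - 3 / 8) * q ≤ (η + a i - 3 / 8) * (p - Real.log 4) :=
          mul_le_mul_of_nonpos_left hpq hs.le
        have e2 : (3 / 8 - η - a i) * Real.log 4 ≤ 3 / 8 * Real.log 4 := by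
          have : 0 ≤ (η + a i) * Real.log 4 := mul_nonneg (by linarith) hlog40
          linarith
        have e3 : 0 ≤ ε * p := mul_nonneg hε.le hp0
        linarith
    calc B ≤ K * F * Real.exp (η * r) * (1 + R / (M * N)) ^ θ * ∑ i ∈ I, Real.exp (a i * q + b i * p) := hbd
      _ ≤ K * F * Real.exp (η * r) * c2θ * ∑ i ∈ I, Real.exp (a i * q + b i * p) := by
          gcongr
      _ = K * F * c2θ * ∑ i ∈ I, Real.exp (η * r) * Real.exp (a i * q + b i * p) := by
          rw [Finset.mul_sum, Finset.mul_sum]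
          refine Finset.sum_congr rfl fun i _ => ?_
          ring
      _ ≤ K * F * c2θ * ∑ i ∈ I, Real.exp (3 / 8 * Real.log 4) * X :=
          mul_le_mul_of_nonneg_left (Finset.sum_le_sum hterm) (by positivity)
      _ = K * F * (c2θ * Real.exp (3 / 8 * Real.log 4)) * (I.card * X) := by
          rw [Finset.sum_const, nsmul_eq_mul]; ring
      _ ≤ (2 + 4 * c2θ * K * I.card) * F * G :=
          hfinal hX0 hG_q (by positivity) (by
            have h := mul_le_mul_of_nonneg_left hexpc (by positivity : (0 : ℝ) ≤ c2θ)
            linarith only [h])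
      _ = _ := by rw [hG]; ring
  · have hRQ' : M * N < R := not_le.mp hRQ
    have hqr : q ≤ r := by rw [hq, hr]; exact Real.log_le_log hQ0 hRQ'.le
    by_cases htr : 1 / 2 * q ≤ 3 / 8 * r + 11 / 48 * p
    · -- the trivial bound suffices
      have hεp : 0 ≤ ε * p := mul_nonneg hε.le hp0
      calc B ≤ 2 * Real.sqrt (M * N) * F := htriv
        _ = 2 * F * Real.exp (1 / 2 * q) := by rw [esqrt]; ring
        _ ≤ 2 * F * Real.exp (3 / 8 * r + (11 / 48 + ε) * p) := by
            gcongr 2 * F * ?_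
            exact Real.exp_le_exp.mpr (by linarith only [htr, hεp])
        _ ≤ 2 * F * G := by gcongr
        _ ≤ (2 + 4 * c2θ * K * I.card) * F * G := by
            have e1 : 0 ≤ F * G := mul_nonneg hF hG0
            have e2 : 0 ≤ c2θ * K * I.card * (F * G) := by positivity
            have e : (2 + 4 * c2θ * K * I.card) * F * G = 2 * (F * G) + 4 * (c2θ * K * I.card * (F * G)) := by ring
            rw [e]; linarith
        _ = _ := by rw [hG]; ring
    · -- the cone: `q < r`, `3/8 r + 11/48 p < 1/2 q`
      have htr' : 3 / 8 * r + 11 / 48 * p < 1 / 2 * q := not_le.mp htr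
      have hfac : (1 + R / (M * N)) ^ θ ≤ c2θ * Real.exp (θ * (r - q)) := by
        have hRQe : R / (M * N) = Real.exp (r - q) := by
          rw [Real.exp_sub, hr, hq, Real.exp_log hR0, Real.exp_log hQ0]
        have e3 : 1 + R / (M * N) ≤ 2 * Real.exp (r - q) := by
          have e4 : 1 ≤ Real.exp (r - q) := Real.one_le_exp (by linarith only [hqr])
          rw [hRQe]; linarith only [e4]
        calc (1 + R / (M * N)) ^ θ ≤ (2 * Real.exp (r - q)) ^ θ := Real.rpow_le_rpow (by positivity) e3 hθ
          _ = c2θ * Real.exp (θ * (r - q)) := by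
              rw [Real.mul_rpow (by norm_num) (Real.exp_pos _).le, ← Real.exp_mul, mul_comm (r - q)]
      set X : ℝ := Real.exp (3 / 8 * r + (11 / 48 + ε) * p) with hX
      have hX0 : 0 ≤ X := (Real.exp_pos _).le
      have hterm : ∀ i ∈ I, Real.exp (η * r) * Real.exp (θ * (r - q)) * Real.exp (a i * q + b i * p) ≤ X := by
        intro i hi
        rw [hX, ← Real.exp_add, ← Real.exp_add]
        refine Real.exp_le_exp.mpr ?_
        have hai := ha i hi
        have h3i := h3 i hi
        have h4i := h4 i hi
        have h1i := h1 i hi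
        -- the region: `q ≤ r ≤ 4/3 q - 11/18 p`, whence `11/6 p ≤ q ≤ 2p`; linear ⇒ corners
        have hrup : r ≤ 4 / 3 * q - 11 / 18 * p := by linarith
        have hqlo : 11 / 6 * p ≤ q := by linarith
        -- `D = (η+θ-3/8) r + (aᵢ-θ) q + (bᵢ - 11/48 - ε) p` is linear on the cone: compare at the corners
        have h3p : (11 / 6 * (η + a i - 3 / 8) + b i) * p ≤ (11 / 48 + ε) * p := mul_le_mul_of_nonneg_right h3i hp0
        have h4p : (37 / 18 * (η + θ - 3 / 8) + 2 * (a i - θ) + b i) * p ≤ (11 / 48 + ε) * p :=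
          mul_le_mul_of_nonneg_right h4i hp0
        have h1p : (2 * (η + a i) + b i) * p ≤ (47 / 48 + ε) * p := mul_le_mul_of_nonneg_right h1i hp0
        rcases le_or_gt 0 (η + θ - 3 / 8) with hs | hs
        · -- nondecreasing in `r`: `r ≤ 4/3 q - 11/18 p`
          have e1 : (η + θ - 3 / 8) * r ≤ (η + θ - 3 / 8) * (4 / 3 * q - 11 / 18 * p) :=
            mul_le_mul_of_nonneg_left hrup hs
          rcases le_or_gt 0 (4 / 3 * (η + θ - 3 / 8) + (a i - θ)) with hs2 | hs2
          · have e2 : (4 / 3 * (η + θ - 3 / 8) + (a i - θ)) * q ≤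
                (4 / 3 * (η + θ - 3 / 8) + (a i - θ)) * (2 * p) := mul_le_mul_of_nonneg_left hqp hs2
            linarith
          · have e2 : (4 / 3 * (η + θ - 3 / 8) + (a i - θ)) * q ≤
                (4 / 3 * (η + θ - 3 / 8) + (a i - θ)) * (11 / 6 * p) := mul_le_mul_of_nonpos_left hqlo hs2.le
            linarith
        · -- decreasing in `r`: `r ≥ q`
          have e1 : (η + θ - 3 / 8) * r ≤ (η + θ - 3 / 8) * q := mul_le_mul_of_nonpos_left hqr hs.le
          rcases le_or_gt 0 (η + a i - 3 / 8) with hs2 | hs2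
          · have e2 : (η + a i - 3 / 8) * q ≤ (η + a i - 3 / 8) * (2 * p) := mul_le_mul_of_nonneg_left hqp hs2
            linarith
          · have e2 : (η + a i - 3 / 8) * q ≤ (η + a i - 3 / 8) * (11 / 6 * p) :=
              mul_le_mul_of_nonpos_left hqlo hs2.le
            linarith
      calc B ≤ K * F * Real.exp (η * r) * (1 + R / (M * N)) ^ θ * ∑ i ∈ I, Real.exp (a i * q + b i * p) := hbd
        _ ≤ K * F * Real.exp (η * r) * (c2θ * Real.exp (θ * (r - q))) * ∑ i ∈ I, Real.exp (a i * q + b i * p) := by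
            gcongr
        _ = K * F * c2θ * ∑ i ∈ I, Real.exp (η * r) * Real.exp (θ * (r - q)) * Real.exp (a i * q + b i * p) := by
            rw [Finset.mul_sum, Finset.mul_sum]
            refine Finset.sum_congr rfl fun i _ => ?_
            ring
        _ ≤ K * F * c2θ * ∑ i ∈ I, X :=
            mul_le_mul_of_nonneg_left (Finset.sum_le_sum hterm) (by positivity)
        _ = K * F * c2θ * (I.card * X) := by rw [Finset.sum_const, nsmul_eq_mul]
        _ ≤ (2 + 4 * c2θ * K * I.card) * F * G :=
            hfinal hX0 hG_r (by positivity) (by linarith only [hc2θ1])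
        _ = _ := by rw [hG]; ring

end Literature.NumberTheory.LFunctions

end
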